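import Literature.Computability.Complexity.MPGSignVerifierRun
import Literature.Computability.Complexity.MeanPayoffGame
import HarnessLib

/-!
# Mean-payoff games over the additive reals: soundness of the certificate verifier

Topic `Literature/Computability/Complexity`, grouping namespace `MPGSignVerifier` (continuing
`MPGSignVerifier.lean`, `MPGSignVerifierRun.lean`). **`sound`**: if the verifier accepts the
witness `y` at `x ∈ ℝⁿ` (every check answered as expected by the sign oracle of `x`, side
conditions true, `n = k + 2k²`), then `x ∈ MPGReal n` — the arena read off `x` is total and vertex
`0` carries the potential certificate `(σ, R, π)` with `σ u = succ u`, `R = {u | inR u}` and the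
REAL potential `π v = Σᵢ coef v i · xᵢ` (any integer combination of the coordinates is a genuine
potential, which is why no shortest-path computation is needed on this side). The owner and edge
bits claimed by the witness are confirmed by the sign tests `x_m ≥ 1`, `x_m ≤ 1` (resp. refuted
strict sides), so the two implications of the certificate (`owner = 1 → …`, `owner ≠ 1 → …`) hold
with the claimed case analysis [ZwickPaterson1995, Thm 7: positional strategy + potential
certificates; FournierKoiran2000, §3].

## References

* U. Zwick, M. Paterson, *The complexity of mean payoff games on graphs*, TCS 158 (1996), Thm 7.
  [ZwickPaterson1995]
* H. Fournier, P. Koiran, *Lower bounds are not easier over the reals: inside PH*, ICALP 2000, §3.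
  [FournierKoiran2000]
-/

namespace Literature.Computability.Complexity

namespace MPGSignVerifier

open _root_.Computability

/-! ### Sign tests -/

section Signs

variable {n : ℕ} (x : Fin n → ℝ) {m : ℕ} (hm : m < n)
include hm

/-- `x_m ≥ 1` answered `true`. [folklore] -/
theorem one_le_of_geOne (h : decide ((0 : ℝ) ≤ qv x (geOne n m)) = true) : 1 ≤ x ⟨m, hm⟩ := by
  rw [decide_eq_true_eq, qv_geOne x hm] at h; linarith

/-- `x_m ≥ 1` answered `false`. [folklore] -/
theorem lt_one_of_geOne (h : decide ((0 : ℝ) ≤ qv x (geOne n m)) = false) : x ⟨m, hm⟩ < 1 := by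
  rw [decide_eq_false_iff_not, qv_geOne x hm] at h; linarith

/-- `x_m ≤ 1` answered `true`. [folklore] -/
theorem le_one_of_leOne (h : decide ((0 : ℝ) ≤ qv x (leOne n m)) = true) : x ⟨m, hm⟩ ≤ 1 := by
  rw [decide_eq_true_eq, qv_leOne x hm] at h; linarith

/-- `x_m ≤ 1` answered `false`. [folklore] -/
theorem one_lt_of_leOne (h : decide ((0 : ℝ) ≤ qv x (leOne n m)) = false) : 1 < x ⟨m, hm⟩ := by
  rw [decide_eq_false_iff_not, qv_leOne x hm] at h; linarith

end Signs

/-! ### Consequences of the checks -/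

section Checks

variable {k : ℕ} (hk : 0 < k) (x : Fin (k + 2 * k * k) → ℝ) (y : List Bool)
  (hchk : ∀ c ∈ checks (env k y), decide ((0 : ℝ) ≤ qv x c.1) = c.2)
include hchk

/-- A Max claim is confirmed: `x_u = 1`. [folklore] -/
theorem eq_one_of_isMax {u : ℕ} (hu : u < k) (hmax : isMax (env k y) u = true) : x ⟨u, vtx_lt hu⟩ = 1 := by
  have h1 := hchk _ (slot1_mem_checks (env k y) (by simpa using hu))
  have h2 := hchk _ (slot2_mem_checks (env k y) (by simpa using hu))
  rw [show slot1 (env k y) u = (geOne (k + 2 * k * k) u, true) by simp [slot1, hmax]] at h1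
  rw [show slot2 (env k y) u = (leOne (k + 2 * k * k) u, true) by simp [slot2, hmax]] at h2
  exact le_antisymm (le_one_of_leOne x (vtx_lt hu) h2) (one_le_of_geOne x (vtx_lt hu) h1)

/-- A Min claim is confirmed: `x_u ≠ 1`. [folklore] -/
theorem ne_one_of_not_isMax {u : ℕ} (hu : u < k) (hmax : isMax (env k y) u = false) : x ⟨u, vtx_lt hu⟩ ≠ 1 := by
  have h1 := hchk _ (slot1_mem_checks (env k y) (by simpa using hu))
  cases hs : side (env k y) u
  · rw [show slot1 (env k y) u = (leOne (k + 2 * k * k) u, false) by simp [slot1, hmax, hs]] at h1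
    exact (one_lt_of_leOne x (vtx_lt hu) h1).ne'
  · rw [show slot1 (env k y) u = (geOne (k + 2 * k * k) u, false) by simp [slot1, hmax, hs]] at h1
    exact (lt_one_of_geOne x (vtx_lt hu) h1).ne

omit hchk in
/-- The value of a potential query at a well-formed input. [folklore] -/
theorem qv_potQ_env {u u' : ℕ} (hu : u < k) (hu' : u' < k) :
    qv x (potQ (env k y) u u') = pot (env k y) x u - pot (env k y) x u' + x ⟨k + k * k + (u * k + u'), wIdx_lt hu hu'⟩ :=
  qv_potQ x y u u' (by rw [show ((k + 2 * k * k, y) : Env) = env k y from rfl, kOf_env]; rfl) (wIdx_lt hu hu')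

include hk in
/-- Totality: the edge `u → tot u` exists. [folklore] -/
theorem edge_tot {u : ℕ} (hu : u < k) :
    x ⟨k + (u * k + tot (env k y) u), edgeIdx_lt hu (tot_lt hk y u)⟩ = 1 := by
  have h3 := hchk _ (slot3_mem_checks (env k y) (by simpa using hu))
  have h4 := hchk _ (slot4_mem_checks (env k y) (by simpa using hu))
  rw [show slot3 (env k y) u = (geOne (k + 2 * k * k) (k + (u * k + tot (env k y) u)), true) by
    simp [slot3, edgeIdx]] at h3
  rw [show slot4 (env k y) u = (leOne (k + 2 * k * k) (k + (u * k + tot (env k y) u)), true) by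
    simp [slot4, edgeIdx]] at h4
  exact le_antisymm (le_one_of_leOne x _ h4) (one_le_of_geOne x _ h3)

include hk in
/-- Max vertex of `R`: the edge `u → σ u` exists. [folklore] -/
theorem edge_succ {u : ℕ} (hu : u < k) (hR : inR (env k y) u = true) (hmax : isMax (env k y) u = true) :
    x ⟨k + (u * k + succ (env k y) u), edgeIdx_lt hu (succ_lt hk y u)⟩ = 1 := by
  have h5 := hchk _ (slot5_mem_checks (env k y) (by simpa using hu) (by simpa using succ_lt hk y u))
  have h6 := hchk _ (slot6_mem_checks (env k y) (by simpa using hu) (by simpa using succ_lt hk y u))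
  rw [show slot5 (env k y) u (succ (env k y) u) = (geOne (k + 2 * k * k) (k + (u * k + succ (env k y) u)), true) by
    simp [slot5, hR, hmax, edgeIdx]] at h5
  rw [show slot6 (env k y) u (succ (env k y) u) = (leOne (k + 2 * k * k) (k + (u * k + succ (env k y) u)), true) by
    simp [slot6, hR, hmax, edgeIdx]] at h6
  exact le_antisymm (le_one_of_leOne x _ h6) (one_le_of_geOne x _ h5)

include hk in
/-- Max vertex of `R`: the potential inequality of `u → σ u`. [folklore] -/
theorem pot_succ_le {u : ℕ} (hu : u < k) (hR : inR (env k y) u = true) (hmax : isMax (env k y) u = true) :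
    pot (env k y) x (succ (env k y) u) ≤
      pot (env k y) x u + x ⟨k + k * k + (u * k + succ (env k y) u), wIdx_lt hu (succ_lt hk y u)⟩ := by
  have h7 := hchk _ (slot7_mem_checks (env k y) (by simpa using hu) (by simpa using succ_lt hk y u))
  rw [show slot7 (env k y) u (succ (env k y) u) = (potQ (env k y) u (succ (env k y) u), true) by
    simp [slot7, hR, hmax]] at h7
  dsimp only at h7
  rw [decide_eq_true_eq, qv_potQ_env x y hu (succ_lt hk y u)] at h7
  linarith

/-- Min vertex of `R`: an existing edge carries no no-edge claim. [folklore] -/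
theorem noEdge_eq_false {u u' : ℕ} (hu : u < k) (hu' : u' < k) (hR : inR (env k y) u = true)
    (hmin : isMax (env k y) u = false) (hedge : x ⟨k + (u * k + u'), edgeIdx_lt hu hu'⟩ = 1) :
    noEdge (env k y) u u' = false := by
  by_contra hne
  rw [Bool.not_eq_false] at hne
  have h5 := hchk _ (slot5_mem_checks (env k y) (by simpa using hu) (by simpa using hu'))
  cases hs : noEdgeSide (env k y) u u'
  · rw [show slot5 (env k y) u u' = (leOne (k + 2 * k * k) (k + (u * k + u')), false) by
      simp [slot5, hR, hmin, hne, hs, edgeIdx]] at h5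
    exact (one_lt_of_leOne x _ h5).ne' hedge
  · rw [show slot5 (env k y) u u' = (geOne (k + 2 * k * k) (k + (u * k + u')), false) by
      simp [slot5, hR, hmin, hne, hs, edgeIdx]] at h5
    exact (lt_one_of_geOne x _ h5).ne hedge

/-- Min vertex of `R`: the potential inequality of an edge without no-edge claim. [folklore] -/
theorem pot_le_of_min {u u' : ℕ} (hu : u < k) (hu' : u' < k) (hR : inR (env k y) u = true)
    (hmin : isMax (env k y) u = false) (hne : noEdge (env k y) u u' = false) :
    pot (env k y) x u' ≤ pot (env k y) x u + x ⟨k + k * k + (u * k + u'), wIdx_lt hu hu'⟩ := by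
  have h6 := hchk _ (slot6_mem_checks (env k y) (by simpa using hu) (by simpa using hu'))
  rw [show slot6 (env k y) u u' = (potQ (env k y) u u', true) by simp [slot6, hR, hmin, hne]] at h6
  dsimp only at h6
  rw [decide_eq_true_eq, qv_potQ_env x y hu hu'] at h6
  linarith

end Checks

/-! ### Consequences of the side conditions -/

section Side

variable {k : ℕ} {y : List Bool} (hside : sideOK (env k y) = true)
include hside

/-- `0 ∈ R`. [folklore] -/
theorem inR_zero : inR (env k y) 0 = true := by
  simp only [sideOK, Bool.and_eq_true] at hside
  exact hside.1

/-- The closure clause of `u ∈ R`. [folklore] -/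
theorem side_of_inR {u : ℕ} (hu : u < k) (hR : inR (env k y) u = true) :
    (if isMax (env k y) u then inR (env k y) (succ (env k y) u)
      else (List.range k).all fun u' => noEdge (env k y) u u' || inR (env k y) u') = true := by
  simp only [sideOK, Bool.and_eq_true, List.all_eq_true, kOf_env] at hside
  have h := hside.2 u (List.mem_range.2 hu)
  simpa [hR] using h

/-- Max vertex of `R`: `σ u ∈ R`. [folklore] -/
theorem inR_succ {u : ℕ} (hu : u < k) (hR : inR (env k y) u = true) (hmax : isMax (env k y) u = true) :
    inR (env k y) (succ (env k y) u) = true := by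
  simpa [hmax] using side_of_inR hside hu hR

/-- Min vertex of `R`: successors without no-edge claim are in `R`. [folklore] -/
theorem inR_of_min {u u' : ℕ} (hu : u < k) (hu' : u' < k) (hR : inR (env k y) u = true)
    (hmin : isMax (env k y) u = false) (hne : noEdge (env k y) u u' = false) : inR (env k y) u' = true := by
  have h := side_of_inR hside hu hR
  simp only [hmin, Bool.false_eq_true, if_false, List.all_eq_true, Bool.or_eq_true, List.mem_range] at h
  exact (h u' hu').resolve_left (by simp [hne])

end Side

/-! ### Soundness -/

/-- Coordinates of `x` through `List.ofFn`. [folklore] -/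
theorem getD_ofFn {n : ℕ} (x : Fin n → ℝ) {m : ℕ} (hm : m < n) : (List.ofFn x).getD m 0 = x ⟨m, hm⟩ := by
  rw [List.getD_eq_getElem?_getD, List.getElem?_ofFn]
  simp [hm]

/-- `2k ≤ k² + 2`. [folklore] -/
theorem two_mul_le_sq_add_two (k : ℕ) : 2 * k ≤ k * k + 2 := by
  rcases Nat.lt_or_ge k 2 with h | h
  · obtain rfl | rfl : k = 0 ∨ k = 1 := by omega
    · norm_num
    · norm_num
  · nlinarith

/-- There are at most `2n + 2` checks on a well-formed input (`4k + 3k² ≤ 2(k + 2k²) + 2`).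
[folklore] -/
theorem length_checks_env_le (k : ℕ) (y : List Bool) : (checks (env k y)).length ≤ 2 * (k + 2 * k * k) + 2 := by
  rw [length_checks, kOf_env]
  have := two_mul_le_sq_add_two k
  nlinarith

/-- **Soundness of the verifier.** If, at `x ∈ ℝⁿ`, the witness `y` is accepted on a transcript
with at least `2n + 2` answers (as many as the verifier asks), then `x ∈ MPGReal n`: the arena is
total and `(succ, {u | inR u}, v ↦ Σᵢ coef v i · xᵢ)` is a potential certificate at vertex `0`.
[cite: ZwickPaterson1995, Thm 7] -/
theorem sound {n : ℕ} (x : Fin n → ℝ) (y : List Bool) {N : ℕ} (hN : 2 * n + 2 ≤ N)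
    (hacc : accepts (n, y) (answers x (n, y) N) = true) : x ∈ MPGReal n := by
  simp only [accepts, Bool.and_eq_true, decide_eq_true_eq] at hacc
  obtain ⟨⟨hvalid, hside⟩, htake⟩ := hacc
  obtain ⟨k, hk, hnk⟩ := (valid_eq_true_iff n).1 hvalid
  subst hnk
  change sideOK (env k y) = true at hside
  have hchk : ∀ c ∈ checks (env k y), decide ((0 : ℝ) ≤ qv x c.1) = c.2 :=
    (take_answers_eq_expected_iff x (env k y) ((length_checks_env_le k y).trans hN)).1 htake
  rw [mem_MPGReal_iff_mpgPred]
  refine ⟨k, hk, rfl, ?_, ?_⟩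
  · -- totality
    intro u
    refine ⟨⟨tot (env k y) u.val, tot_lt hk y u.val⟩, ?_⟩
    show (List.ofFn x).getD (k + (u.val * k + tot (env k y) u.val)) 0 = 1
    rw [getD_ofFn x (edgeIdx_lt u.isLt (tot_lt hk y u.val))]
    exact edge_tot hk x y hchk u.isLt
  · refine ⟨fun u => ⟨succ (env k y) u.val, succ_lt hk y u.val⟩, {u | inR (env k y) u.val = true},
      fun v => pot (env k y) x v.val, ⟨⟨0, hk⟩, inR_zero hside, rfl⟩,
      fun u huR => ⟨fun hown => ?_, fun hown u' hedge => ?_⟩⟩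
    · -- Max vertex of `R`
      have hu : u.val < k := u.isLt
      have hR : inR (env k y) u.val = true := huR
      change (List.ofFn x).getD u.val 0 = 1 at hown
      rw [getD_ofFn x (vtx_lt hu)] at hown
      have hmax : isMax (env k y) u.val = true := by
        by_contra h
        rw [Bool.not_eq_true] at h
        exact ne_one_of_not_isMax x y hchk hu h hown
      refine ⟨?_, inR_succ hside hu hR hmax, ?_⟩
      · show (List.ofFn x).getD (k + (u.val * k + succ (env k y) u.val)) 0 = 1
        rw [getD_ofFn x (edgeIdx_lt hu (succ_lt hk y u.val))]
        exact edge_succ hk x y hchk hu hR hmax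
      · show pot (env k y) x (succ (env k y) u.val) ≤
          pot (env k y) x u.val + (List.ofFn x).getD (k + k * k + (u.val * k + succ (env k y) u.val)) 0
        rw [getD_ofFn x (wIdx_lt hu (succ_lt hk y u.val))]
        exact pot_succ_le hk x y hchk hu hR hmax
    · -- Min vertex of `R`
      have hu : u.val < k := u.isLt
      have hR : inR (env k y) u.val = true := huR
      change (List.ofFn x).getD u.val 0 ≠ 1 at hown
      rw [getD_ofFn x (vtx_lt hu)] at hown
      have hmin : isMax (env k y) u.val = false := by
        by_contra h
        rw [Bool.not_eq_false] at h
        exact hown (eq_one_of_isMax x y hchk hu h)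
      change (List.ofFn x).getD (k + (u.val * k + u'.val)) 0 = 1 at hedge
      rw [getD_ofFn x (edgeIdx_lt hu u'.isLt)] at hedge
      have hne := noEdge_eq_false x y hchk hu u'.isLt hR hmin hedge
      refine ⟨inR_of_min hside hu u'.isLt hR hmin hne, ?_⟩
      show pot (env k y) x u'.val ≤ pot (env k y) x u.val + (List.ofFn x).getD (k + k * k + (u.val * k + u'.val)) 0
      rw [getD_ofFn x (wIdx_lt hu u'.isLt)]
      exact pot_le_of_min x y hchk hu u'.isLt hR hmin hne

end MPGSignVerifier

end Literature.Computability.Complexity
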